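import Literature.NumberTheory.GaloisCohomology.KolyvaginSystems
import Literature.NumberTheory.EllipticCurves.KummerSelmerStructure
import HarnessLib

/-!
# Injectivity dévissage for Kolyvagin systems along a short exact sequence of Galois modules
# (cell `b2b-bsdres`, team n1011, seat p15 GEN 4, OWNERS row T-INJ-DEV, file F-A;
# skeleton `cells/n1011/skel/T-INJ-DEV.md`)

HONEST FRAMING (cell `b2b-bsdres`, run/shared/lean/b2b/bsd-rank1-residual/, verbatim in every
file): the goal of the cell is to DELETE the COMBINATION-SHAPED residual classes of the
Birch–Swinnerton-Dyer formula for ALL analytic-rank `≤ 1` elliptic curves over `ℚ` — "full BSD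
formula for every rank `≤ 1` curve in class `C`" assembled STRICTLY from published theorems — so
that the rank-`≤ 1` remainder becomes exactly the CONSTRUCTION-SHAPED classes, which are TYPED
(missing-input `Prop`s), NOT attempted. This is not "finishing BSD". Team n1011 (N10 / N11, the
additive block X4 ∧ `p = 3`): research route on the CONSTRUCTION-SHAPED class X4; TOOL theorems about
Kolyvagin systems of ARBITRARY discrete Galois modules over a number field; no class theorem; nothing
is booked; no label and no RESIDUAL-MAP mark is moved. Theorems only: no definition, no named fact,
no `sorry`.

## What and why
The INJECTIVITY half of the structure theorem for Kolyvagin systems ("evaluation at a core vertex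
`n₀` is injective on `KS(T/p^m)`", [MR04] Thm. 4.4.1 / [S24] Thm. 4.4 (1)) passes from length `m`
to `m + 1` by dévissage along the short exact sequence of coefficients.  This file is the GENERIC
step, for equivariant maps `i : M₁ → M₂`, `π : M₂ → M₃` of discrete `Γ_K`-modules (intended:
`0 → E[p] → E[p²] → E[p] → 0`, file F-B2 of the row), Kolyvagin data `D₁ D₂ D₃` with the SAME
primes and Selmer structures `𝓕₁ 𝓕₂ 𝓕₃`: §1 `isKolyvaginSystem_map` (PUSH-FORWARD `π_* κ` under
local hypotheses: `π_*` maps `𝓕₂` into `𝓕₃`, `𝒯₂` into `𝒯₃`, and TRANSPORTS the finite–singular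
comparison maps on unramified classes, in "reflect" form on representatives of the singular
quotient); §2 `isKolyvaginSystem_lift` (PULL-BACK along `i_*` under the dual hypotheses:
`𝓕₁ ⊇ i_*⁻¹ 𝓕₂` = Sakamoto's CARTESIAN condition Def. 3.5 in the direction used, same for `𝒯`,
comparison maps REFLECT); §3 **`apply_eq_zero_of_apply_eq_zero_of_devissage`**: if
`H¹(K,M₁) → H¹(K,M₂) → H¹(K,M₃)` is exact with injective first map and evaluation at `n₀` is
injective on `KS(D₁,𝓕₁)` and on `KS(D₃,𝓕₃)` (`hinj₁`, `hinj₃` — the conclusion shape of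
n1011-p11's `CoreRankOne.apply_eq_zero_of_apply_core_eq_zero`, ROUTE-1 R1-56 (G) / R1-58), then it
is injective on `KS(D₂,𝓕₂)` (`κ_{n₀} = 0 ⟹ π_*κ ≡ 0 ⟹ κ = i_*λ ⟹ λ_{n₀} = 0 ⟹ λ ≡ 0 ⟹ κ ≡ 0`);
`…_self` = the form `M₁ = M₃`, `D₁ = D₃`, `𝓕₁ = 𝓕₃` (ONE hypothesis `hinj`).  No arithmetic input;
the file iterates (`0 → T/p → T/p^{m+1} → T/p^m → 0`).  [MR04] §4.5 proves the structure theorem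
over a principal artinian ring by an induction on the length of this shape (not held, acq-02261 —
the statements here are self-contained).

References: B. Mazur, K. Rubin, *Kolyvagin systems*, Mem. AMS 799 (2004) Thm. 4.4.1, §4.5;
R. Sakamoto, JTNB 36 (2024) Def. 3.5 (cartesian), Def. 4.1 (Kolyvagin systems), Thm. 4.4
[Sakamoto2024]; K. Rubin, PCMI 18 (2011) Def. 2.2.1 [Rubin2011].
-/

noncomputable section

open scoped Classical NumberField ContRepresentation
open Field NumberField IsDedekindDomain
open Literature.NumberTheory.GaloisRepresentations Literature.NumberTheory.GaloisRepresentations.DiscreteGaloisModule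
  Literature.NumberTheory.GaloisCohomology

universe u
namespace Summit.BirchSwinnertonDyer.Rank1Residual.GaloisImage.KSDevissage
variable {K : Type u} [Field K] [NumberField K]
variable {M₁ M₂ M₃ : Type u}
  [AddCommGroup M₁] [TopologicalSpace M₁] [DiscreteTopology M₁]
  [AddCommGroup M₂] [TopologicalSpace M₂] [DiscreteTopology M₂]
  [AddCommGroup M₃] [TopologicalSpace M₃] [DiscreteTopology M₃]
variable {ρ₁ : DiscreteGaloisModule K M₁} {ρ₂ : DiscreteGaloisModule K M₂}
  {ρ₃ : DiscreteGaloisModule K M₃}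

/-! ### §0 Bookkeeping: levels, the structures `𝓕(d)` place by place, localisation -/
/-- Localisation commutes with the map induced by an equivariant map:
`loc_v (f_* c) = (f|_{Γ_{K_v}})_* (loc_v c)` (the tree's `galoisCohomology.res_map_one` at `K_v`,
spelled with `localMap`). [folklore] -/
theorem localization_map_one (f : ρ₁.toContRepresentation →ⁱL ρ₂.toContRepresentation)
    (v : Place K) (c : galoisCohomology ρ₁ 1) :
    galoisCohomology.localization ρ₂ v 1 (galoisCohomology.map f 1 c) =
      localMap f v (galoisCohomology.localization ρ₁ v 1 c) :=
  galoisCohomology.res_map_one (Place.Completion v) f c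

/-- Two data with the same primes have the same levels. [cite: Sakamoto2024, §2 (p. 921)] -/
theorem isLevel_iff_of_primes_eq {D : KolyvaginDatum ρ₁} {D' : KolyvaginDatum ρ₂}
    (hP : D.primes = D'.primes) (d : Finset (HeightOneSpectrum (𝓞 K))) :
    D.IsLevel d ↔ D'.IsLevel d := by
  simp only [KolyvaginDatum.IsLevel, hP]

/-- **`𝓕(d)` is mapped into `𝓕′(d)` place by place** when `f_*` maps `𝓕` into `𝓕′` everywhere and
the transverse conditions of `D` into those of `D′` at the primes (`𝓕(d)` = `𝓕` off `d`,
transverse on `d`; Sakamoto Def. 3.3). [cite: Sakamoto2024, Def. 3.3 (p. 922)] -/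
theorem localMap_mem_atLevel (f : ρ₁.toContRepresentation →ⁱL ρ₂.toContRepresentation)
    {D : KolyvaginDatum ρ₁} {D' : KolyvaginDatum ρ₂} {𝓕 : SelmerStructure ρ₁}
    {𝓕' : SelmerStructure ρ₂}
    (hF : ∀ v, ∀ y ∈ 𝓕 v, localMap f v y ∈ 𝓕' v)
    (hT : ∀ q ∈ D.primes, ∀ y ∈ D.transverse (Sum.inr q),
      localMap f (Sum.inr q) y ∈ D'.transverse (Sum.inr q))
    {d : Finset (HeightOneSpectrum (𝓞 K))} (hd : D.IsLevel d) (v : Place K)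
    {y : galoisCohomology (ρ₁.toLocal v) 1} (hy : y ∈ D.atLevel 𝓕 d v) :
    localMap f v y ∈ D'.atLevel 𝓕' d v := by
  cases v with
  | inl w => exact hF _ y hy
  | inr q =>
    by_cases hq : q ∈ d
    · rw [KolyvaginDatum.atLevel, SelmerStructure.transverseAt,
        SelmerStructure.modify_inr_of_mem_transverse _ _ (Finset.notMem_empty q)
          (Finset.notMem_empty q) hq] at hy ⊢
      exact hT q (hd hq) y hy
    · rw [KolyvaginDatum.atLevel, SelmerStructure.transverseAt,
        SelmerStructure.modify_inr_of_not_mem _ _ (Finset.notMem_empty q)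
          (Finset.notMem_empty q) hq] at hy ⊢
      exact hF _ y hy

/-- **`𝓕(d) ⊇ f_*⁻¹ 𝓕′(d)` place by place** (the CARTESIAN direction, Sakamoto Def. 3.5) when
`𝓕 ⊇ f_*⁻¹ 𝓕′` everywhere and the same holds for the transverse conditions at the primes.
[cite: Sakamoto2024, Def. 3.3 (p. 922) and Def. 3.5 (p. 923)] -/
theorem mem_atLevel_of_localMap_mem (f : ρ₁.toContRepresentation →ⁱL ρ₂.toContRepresentation)
    {D : KolyvaginDatum ρ₁} {D' : KolyvaginDatum ρ₂} {𝓕 : SelmerStructure ρ₁}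
    {𝓕' : SelmerStructure ρ₂}
    (hF : ∀ v x, localMap f v x ∈ 𝓕' v → x ∈ 𝓕 v)
    (hT : ∀ q ∈ D.primes, ∀ x, localMap f (Sum.inr q) x ∈ D'.transverse (Sum.inr q) →
      x ∈ D.transverse (Sum.inr q))
    {d : Finset (HeightOneSpectrum (𝓞 K))} (hd : D.IsLevel d) (v : Place K)
    {x : galoisCohomology (ρ₁.toLocal v) 1} (hx : localMap f v x ∈ D'.atLevel 𝓕' d v) :
    x ∈ D.atLevel 𝓕 d v := by
  cases v with
  | inl w => exact hF _ x hx
  | inr q =>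
    by_cases hq : q ∈ d
    · rw [KolyvaginDatum.atLevel, SelmerStructure.transverseAt,
        SelmerStructure.modify_inr_of_mem_transverse _ _ (Finset.notMem_empty q)
          (Finset.notMem_empty q) hq] at hx ⊢
      exact hT q (hd hq) x hx
    · rw [KolyvaginDatum.atLevel, SelmerStructure.transverseAt,
        SelmerStructure.modify_inr_of_not_mem _ _ (Finset.notMem_empty q)
          (Finset.notMem_empty q) hq] at hx ⊢
      exact hF _ x hx

/-- Off the level, `𝓕(d)_𝔮 = 𝓕_𝔮`; so if `𝓕` is unramified at the primes of the datum, a class in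
`𝓕(d)_𝔮` at a prime `𝔮 ∉ d` of the datum is unramified. [cite: Sakamoto2024, Def. 3.3 (p. 922)] -/
theorem mem_unramifiedSubgroup_of_mem_atLevel {D : KolyvaginDatum ρ₁} {𝓕 : SelmerStructure ρ₁}
    (hur : ∀ q ∈ D.primes, 𝓕 (Sum.inr q) ≤ unramifiedSubgroup (GaloisRep.toLocal q ρ₁) 1)
    {d : Finset (HeightOneSpectrum (𝓞 K))} {q : HeightOneSpectrum (𝓞 K)} (hq : q ∈ D.primes)
    (hqd : q ∉ d) {y : galoisCohomology (ρ₁.toLocal (Sum.inr q)) 1}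
    (hy : y ∈ D.atLevel 𝓕 d (Sum.inr q)) :
    y ∈ unramifiedSubgroup (GaloisRep.toLocal q ρ₁) 1 := by
  rw [KolyvaginDatum.atLevel, SelmerStructure.transverseAt,
    SelmerStructure.modify_inr_of_not_mem _ _ (Finset.notMem_empty q) (Finset.notMem_empty q)
      hqd] at hy
  exact hur q hq hy

/-! ### §1 Push-forward of Kolyvagin systems along `π : M₂ → M₃` -/
/-- **Push-forward of a Kolyvagin system.**  Let `π : M₂ → M₃` be `Γ_K`-equivariant, `D₂`, `D₃`
Kolyvagin data with the same primes, `𝓕₂` unramified at those primes, and suppose that `π_*` maps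
`𝓕₂` into `𝓕₃` at every place and `𝒯₂` into `𝒯₃` at the primes, and TRANSPORTS the comparison
maps on unramified classes: whenever `w` represents `φ^{fs}_𝔮(y)` modulo `H¹_ur(K_𝔮, M₂)`, `π_* w`
represents `φ^{fs}_𝔮(π_* y)` modulo `H¹_ur(K_𝔮, M₃)`.  Then `d ↦ π_*(κ_d)` is a Kolyvagin system for
`(D₃, 𝓕₃)` for every Kolyvagin system `κ` for `(D₂, 𝓕₂)` (Sakamoto Def. 4.1: support on the levels,
`κ_d ∈ H¹_{𝓕(d)}`, and the finite–singular relation, each transported). [cite: Sakamoto2024, Def. 4.1 (p. 926)]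
[cite: Rubin2011, Def. 2.2.1 (p. 18)] -/
theorem isKolyvaginSystem_map (π : ρ₂.toContRepresentation →ⁱL ρ₃.toContRepresentation)
    {D₂ : KolyvaginDatum ρ₂} {D₃ : KolyvaginDatum ρ₃} (hP : D₃.primes = D₂.primes)
    {𝓕₂ : SelmerStructure ρ₂} {𝓕₃ : SelmerStructure ρ₃}
    (hur₂ : ∀ q ∈ D₂.primes, 𝓕₂ (Sum.inr q) ≤ unramifiedSubgroup (GaloisRep.toLocal q ρ₂) 1)
    (hF : ∀ v, ∀ y ∈ 𝓕₂ v, localMap π v y ∈ 𝓕₃ v)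
    (hT : ∀ q ∈ D₂.primes, ∀ y ∈ D₂.transverse (Sum.inr q),
      localMap π (Sum.inr q) y ∈ D₃.transverse (Sum.inr q))
    (hfs : ∀ q ∈ D₂.primes, ∀ y ∈ unramifiedSubgroup (GaloisRep.toLocal q ρ₂) 1,
      ∀ w : galoisCohomology (GaloisRep.toLocal q ρ₂) 1,
        singularMap (GaloisRep.toLocal q ρ₂) w = D₂.fs q y →
          singularMap (GaloisRep.toLocal q ρ₃) (localMap π (Sum.inr q) w) =
            D₃.fs q (localMap π (Sum.inr q) y))
    {κ : Finset (HeightOneSpectrum (𝓞 K)) → galoisCohomology ρ₂ 1}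
    (hκ : D₂.IsKolyvaginSystem 𝓕₂ κ) :
    D₃.IsKolyvaginSystem 𝓕₃ (fun d => galoisCohomology.map π 1 (κ d)) := by
  refine ⟨fun d hd => ?_, fun d hd => ?_, fun d hd q hq hqd => ?_⟩
  · -- support
    rw [hκ.eq_zero_of_not_isLevel d (fun h => hd ((isLevel_iff_of_primes_eq hP d).mpr h)), map_zero]
  · -- Selmer condition
    have hd₂ : D₂.IsLevel d := (isLevel_iff_of_primes_eq hP d).mp hd
    rw [SelmerStructure.mem_selmerGroup_iff]
    intro v
    rw [localization_map_one]
    exact localMap_mem_atLevel π hF hT hd₂ v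
      ((SelmerStructure.mem_selmerGroup_iff _ _).mp (hκ.mem_selmerGroup d hd₂) v)
  · -- finite–singular relation
    have hq₂ : q ∈ D₂.primes := hP ▸ hq
    have hd₂ : D₂.IsLevel d := (isLevel_iff_of_primes_eq hP d).mp hd
    have hy : galoisCohomology.localization ρ₂ (Sum.inr q) 1 (κ d) ∈
        unramifiedSubgroup (GaloisRep.toLocal q ρ₂) 1 :=
      mem_unramifiedSubgroup_of_mem_atLevel hur₂ hq₂ hqd
        ((SelmerStructure.mem_selmerGroup_iff _ _).mp (hκ.mem_selmerGroup d hd₂) (Sum.inr q))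
    have hrel := hκ.fs_rel d hd₂ q hq₂ hqd
    change singularMap (GaloisRep.toLocal q ρ₂)
        (galoisCohomology.localization ρ₂ (Sum.inr q) 1 (κ (insert q d))) =
      D₂.fs q (galoisCohomology.localization ρ₂ (Sum.inr q) 1 (κ d)) at hrel
    change singularMap (GaloisRep.toLocal q ρ₃)
        (galoisCohomology.localization ρ₃ (Sum.inr q) 1 (galoisCohomology.map π 1 (κ (insert q d)))) =
      D₃.fs q (galoisCohomology.localization ρ₃ (Sum.inr q) 1 (galoisCohomology.map π 1 (κ d)))
    rw [localization_map_one, localization_map_one]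
    exact hfs q hq₂ _ hy _ hrel

/-! ### §2 Pull-back of Kolyvagin systems along `i : M₁ → M₂` -/
/-- **Pull-back of a Kolyvagin system along `i : M₁ → M₂`.**  Let `D₁`, `D₂` be Kolyvagin data with
the same primes, `𝓕₁` unramified at those primes, and suppose the CARTESIAN conditions
`i_* x ∈ 𝓕₂,v ⟹ x ∈ 𝓕₁,v` (every place; Sakamoto Def. 3.5) and `i_* x ∈ 𝒯₂,𝔮 ⟹ x ∈ 𝒯₁,𝔮` (the
primes), and that the comparison maps REFLECT along `i_*` on unramified classes.  If `κ` is a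
Kolyvagin system for `(D₂, 𝓕₂)` and `λ` is a family of classes of `M₁` with `i_* λ_d = κ_d` for all
`d` and `λ_d = 0` wherever `κ_d = 0`, then `λ` is a Kolyvagin system for `(D₁, 𝓕₁)`.
[cite: Sakamoto2024, Def. 3.5 (p. 923) and Def. 4.1 (p. 926)] [cite: Rubin2011, Def. 2.2.1 (p. 18)] -/
theorem isKolyvaginSystem_lift (i : ρ₁.toContRepresentation →ⁱL ρ₂.toContRepresentation)
    {D₁ : KolyvaginDatum ρ₁} {D₂ : KolyvaginDatum ρ₂} (hP : D₁.primes = D₂.primes)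
    {𝓕₁ : SelmerStructure ρ₁} {𝓕₂ : SelmerStructure ρ₂}
    (hur₁ : ∀ q ∈ D₂.primes, 𝓕₁ (Sum.inr q) ≤ unramifiedSubgroup (GaloisRep.toLocal q ρ₁) 1)
    (hF : ∀ v x, localMap i v x ∈ 𝓕₂ v → x ∈ 𝓕₁ v)
    (hT : ∀ q ∈ D₂.primes, ∀ x, localMap i (Sum.inr q) x ∈ D₂.transverse (Sum.inr q) →
      x ∈ D₁.transverse (Sum.inr q))
    (hfs : ∀ q ∈ D₂.primes, ∀ y ∈ unramifiedSubgroup (GaloisRep.toLocal q ρ₁) 1,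
      ∀ w : galoisCohomology (GaloisRep.toLocal q ρ₁) 1,
        singularMap (GaloisRep.toLocal q ρ₂) (localMap i (Sum.inr q) w) =
            D₂.fs q (localMap i (Sum.inr q) y) →
          singularMap (GaloisRep.toLocal q ρ₁) w = D₁.fs q y)
    {κ : Finset (HeightOneSpectrum (𝓞 K)) → galoisCohomology ρ₂ 1}
    (hκ : D₂.IsKolyvaginSystem 𝓕₂ κ)
    {lam : Finset (HeightOneSpectrum (𝓞 K)) → galoisCohomology ρ₁ 1}
    (hlam : ∀ d, galoisCohomology.map i 1 (lam d) = κ d) (hlam0 : ∀ d, κ d = 0 → lam d = 0) :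
    D₁.IsKolyvaginSystem 𝓕₁ lam := by
  -- Selmer condition first (used again in the finite–singular relation)
  have hsel : ∀ d, D₁.IsLevel d → lam d ∈ (D₁.atLevel 𝓕₁ d).selmerGroup := by
    intro d hd
    have hd₂ : D₂.IsLevel d := (isLevel_iff_of_primes_eq hP d).mp hd
    rw [SelmerStructure.mem_selmerGroup_iff]
    intro v
    refine mem_atLevel_of_localMap_mem i hF (fun q hq => hT q (hP ▸ hq)) hd v ?_
    rw [← localization_map_one, hlam d]
    exact (SelmerStructure.mem_selmerGroup_iff _ _).mp (hκ.mem_selmerGroup d hd₂) v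
  refine ⟨fun d hd => ?_, hsel, fun d hd q hq hqd => ?_⟩
  · -- support
    exact hlam0 d (hκ.eq_zero_of_not_isLevel d (fun h => hd ((isLevel_iff_of_primes_eq hP d).mpr h)))
  · -- finite–singular relation
    have hq₂ : q ∈ D₂.primes := hP ▸ hq
    have hd₂ : D₂.IsLevel d := (isLevel_iff_of_primes_eq hP d).mp hd
    have hy : galoisCohomology.localization ρ₁ (Sum.inr q) 1 (lam d) ∈
        unramifiedSubgroup (GaloisRep.toLocal q ρ₁) 1 :=
      mem_unramifiedSubgroup_of_mem_atLevel (D := D₁) (fun q hq => hur₁ q (hP ▸ hq)) hq hqd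
        ((SelmerStructure.mem_selmerGroup_iff _ _).mp (hsel d hd) (Sum.inr q))
    have hrel := hκ.fs_rel d hd₂ q hq₂ hqd
    change singularMap (GaloisRep.toLocal q ρ₂)
        (galoisCohomology.localization ρ₂ (Sum.inr q) 1 (κ (insert q d))) =
      D₂.fs q (galoisCohomology.localization ρ₂ (Sum.inr q) 1 (κ d)) at hrel
    rw [← hlam (insert q d), ← hlam d, localization_map_one, localization_map_one] at hrel
    exact hfs q hq₂ _ hy _ hrel

omit [NumberField K] in
/-- The unique lift along an injective `i_*` of a family of classes in its range, and its support.
[folklore] -/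
theorem exists_lift_of_forall_mem_range (i : ρ₁.toContRepresentation →ⁱL ρ₂.toContRepresentation)
    (hinji : Function.Injective (galoisCohomology.map i 1))
    {κ : Finset (HeightOneSpectrum (𝓞 K)) → galoisCohomology ρ₂ 1}
    (hrange : ∀ d, ∃ y, galoisCohomology.map i 1 y = κ d) :
    ∃ lam : Finset (HeightOneSpectrum (𝓞 K)) → galoisCohomology ρ₁ 1,
      (∀ d, galoisCohomology.map i 1 (lam d) = κ d) ∧ ∀ d, κ d = 0 → lam d = 0 := by
  choose lam hlam using hrange
  refine ⟨lam, hlam, fun d hd => hinji ?_⟩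
  rw [hlam d, hd, map_zero]

/-! ### §3 The dévissage -/
/-- **Injectivity dévissage for Kolyvagin systems.**  Let `i : M₁ → M₂`, `π : M₂ → M₃` be
`Γ_K`-equivariant with `H¹(K, M₁) →(i_*) H¹(K, M₂) →(π_*) H¹(K, M₃)` exact at `H¹(K, M₂)` and `i_*`
injective; let `D₁`, `D₂`, `D₃` be Kolyvagin data with the same primes and `𝓕₁`, `𝓕₂`, `𝓕₃`
Selmer structures, `𝓕₁`, `𝓕₂` unramified at the primes, with the push-forward hypotheses of
`isKolyvaginSystem_map` for `π` and the pull-back hypotheses of `isKolyvaginSystem_lift` for `i`.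
If evaluation at the level `n₀` is injective on the Kolyvagin systems of `(D₁, 𝓕₁)` and of
`(D₃, 𝓕₃)`, it is injective on those of `(D₂, 𝓕₂)`: a Kolyvagin system `κ` for `(D₂, 𝓕₂)` with
`κ_{n₀} = 0` vanishes identically.  (The induction step "length `m` ⟹ length `m + 1`" of the
injectivity half of the structure theorem; intended use `0 → E[p] → E[p²] → E[p] → 0` with
`hinj₁ = hinj₃` = the `m = 1` injectivity, ROUTE-1 R1-56 (G) / R1-58.)
[cite: Sakamoto2024, Def. 3.5 (p. 923), Def. 4.1 and Thm. 4.4 (1) (p. 926)]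
[cite: Rubin2011, Def. 2.2.1 (p. 18)] -/
theorem apply_eq_zero_of_apply_eq_zero_of_devissage
    (i : ρ₁.toContRepresentation →ⁱL ρ₂.toContRepresentation)
    (π : ρ₂.toContRepresentation →ⁱL ρ₃.toContRepresentation)
    (hexact : ∀ x, galoisCohomology.map π 1 x = 0 → ∃ y, galoisCohomology.map i 1 y = x)
    (hinji : Function.Injective (galoisCohomology.map i 1))
    {D₁ : KolyvaginDatum ρ₁} {D₂ : KolyvaginDatum ρ₂} {D₃ : KolyvaginDatum ρ₃}
    (hP₁ : D₁.primes = D₂.primes) (hP₃ : D₃.primes = D₂.primes)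
    {𝓕₁ : SelmerStructure ρ₁} {𝓕₂ : SelmerStructure ρ₂} {𝓕₃ : SelmerStructure ρ₃}
    (hur₁ : ∀ q ∈ D₂.primes, 𝓕₁ (Sum.inr q) ≤ unramifiedSubgroup (GaloisRep.toLocal q ρ₁) 1)
    (hur₂ : ∀ q ∈ D₂.primes, 𝓕₂ (Sum.inr q) ≤ unramifiedSubgroup (GaloisRep.toLocal q ρ₂) 1)
    (hFπ : ∀ v, ∀ y ∈ 𝓕₂ v, localMap π v y ∈ 𝓕₃ v)
    (hTπ : ∀ q ∈ D₂.primes, ∀ y ∈ D₂.transverse (Sum.inr q),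
      localMap π (Sum.inr q) y ∈ D₃.transverse (Sum.inr q))
    (hfsπ : ∀ q ∈ D₂.primes, ∀ y ∈ unramifiedSubgroup (GaloisRep.toLocal q ρ₂) 1,
      ∀ w : galoisCohomology (GaloisRep.toLocal q ρ₂) 1,
        singularMap (GaloisRep.toLocal q ρ₂) w = D₂.fs q y →
          singularMap (GaloisRep.toLocal q ρ₃) (localMap π (Sum.inr q) w) =
            D₃.fs q (localMap π (Sum.inr q) y))
    (hFi : ∀ v x, localMap i v x ∈ 𝓕₂ v → x ∈ 𝓕₁ v)
    (hTi : ∀ q ∈ D₂.primes, ∀ x, localMap i (Sum.inr q) x ∈ D₂.transverse (Sum.inr q) →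
      x ∈ D₁.transverse (Sum.inr q))
    (hfsi : ∀ q ∈ D₂.primes, ∀ y ∈ unramifiedSubgroup (GaloisRep.toLocal q ρ₁) 1,
      ∀ w : galoisCohomology (GaloisRep.toLocal q ρ₁) 1,
        singularMap (GaloisRep.toLocal q ρ₂) (localMap i (Sum.inr q) w) =
            D₂.fs q (localMap i (Sum.inr q) y) →
          singularMap (GaloisRep.toLocal q ρ₁) w = D₁.fs q y)
    {n₀ : Finset (HeightOneSpectrum (𝓞 K))}
    (hinj₁ : ∀ lam : Finset (HeightOneSpectrum (𝓞 K)) → galoisCohomology ρ₁ 1,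
      D₁.IsKolyvaginSystem 𝓕₁ lam → lam n₀ = 0 → ∀ n, lam n = 0)
    (hinj₃ : ∀ μ : Finset (HeightOneSpectrum (𝓞 K)) → galoisCohomology ρ₃ 1,
      D₃.IsKolyvaginSystem 𝓕₃ μ → μ n₀ = 0 → ∀ n, μ n = 0)
    {κ : Finset (HeightOneSpectrum (𝓞 K)) → galoisCohomology ρ₂ 1}
    (hκ : D₂.IsKolyvaginSystem 𝓕₂ κ) (h0 : κ n₀ = 0) (n : Finset (HeightOneSpectrum (𝓞 K))) : κ n = 0 := by
  -- push forward: `π_* κ` is a Kolyvagin system vanishing at `n₀`, hence everywhere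
  have hπκ : D₃.IsKolyvaginSystem 𝓕₃ (fun d => galoisCohomology.map π 1 (κ d)) :=
    isKolyvaginSystem_map π hP₃ hur₂ hFπ hTπ hfsπ hκ
  have hzero : ∀ d, galoisCohomology.map π 1 (κ d) = 0 :=
    hinj₃ _ hπκ (by rw [h0, map_zero])
  -- lift: `κ = i_* λ` with `λ` a Kolyvagin system vanishing at `n₀`, hence everywhere
  obtain ⟨lam, hlam, hlam0⟩ :=
    exists_lift_of_forall_mem_range i hinji (fun d => hexact (κ d) (hzero d))
  have hlamKS : D₁.IsKolyvaginSystem 𝓕₁ lam :=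
    isKolyvaginSystem_lift i hP₁ hur₁ hFi hTi hfsi hκ hlam hlam0
  rw [← hlam n, hinj₁ lam hlamKS (hlam0 n₀ h0) n, map_zero]

/-- **Injectivity dévissage, self-dual form** (`M₁ = M₃`, one datum `D₁` and one structure `𝓕₁` on
both ends — the case `0 → E[p] →(incl) E[p²] →([p]) E[p] → 0` with `𝓕̄_can` on both copies of
`E[p]`): ONE injectivity hypothesis `hinj` at the level `n₀` on the Kolyvagin systems of `(D₁, 𝓕₁)`
gives injectivity at `n₀` on those of `(D₂, 𝓕₂)`.
[cite: Sakamoto2024, Def. 3.5 (p. 923), Def. 4.1 and Thm. 4.4 (1) (p. 926)] -/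
theorem apply_eq_zero_of_apply_eq_zero_of_devissage_self
    (i : ρ₁.toContRepresentation →ⁱL ρ₂.toContRepresentation)
    (π : ρ₂.toContRepresentation →ⁱL ρ₁.toContRepresentation)
    (hexact : ∀ x, galoisCohomology.map π 1 x = 0 → ∃ y, galoisCohomology.map i 1 y = x)
    (hinji : Function.Injective (galoisCohomology.map i 1))
    {D₁ : KolyvaginDatum ρ₁} {D₂ : KolyvaginDatum ρ₂} (hP₁ : D₁.primes = D₂.primes)
    {𝓕₁ : SelmerStructure ρ₁} {𝓕₂ : SelmerStructure ρ₂}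
    (hur₁ : ∀ q ∈ D₂.primes, 𝓕₁ (Sum.inr q) ≤ unramifiedSubgroup (GaloisRep.toLocal q ρ₁) 1)
    (hur₂ : ∀ q ∈ D₂.primes, 𝓕₂ (Sum.inr q) ≤ unramifiedSubgroup (GaloisRep.toLocal q ρ₂) 1)
    (hFπ : ∀ v, ∀ y ∈ 𝓕₂ v, localMap π v y ∈ 𝓕₁ v)
    (hTπ : ∀ q ∈ D₂.primes, ∀ y ∈ D₂.transverse (Sum.inr q),
      localMap π (Sum.inr q) y ∈ D₁.transverse (Sum.inr q))
    (hfsπ : ∀ q ∈ D₂.primes, ∀ y ∈ unramifiedSubgroup (GaloisRep.toLocal q ρ₂) 1,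
      ∀ w : galoisCohomology (GaloisRep.toLocal q ρ₂) 1,
        singularMap (GaloisRep.toLocal q ρ₂) w = D₂.fs q y →
          singularMap (GaloisRep.toLocal q ρ₁) (localMap π (Sum.inr q) w) =
            D₁.fs q (localMap π (Sum.inr q) y))
    (hFi : ∀ v x, localMap i v x ∈ 𝓕₂ v → x ∈ 𝓕₁ v)
    (hTi : ∀ q ∈ D₂.primes, ∀ x, localMap i (Sum.inr q) x ∈ D₂.transverse (Sum.inr q) →
      x ∈ D₁.transverse (Sum.inr q))
    (hfsi : ∀ q ∈ D₂.primes, ∀ y ∈ unramifiedSubgroup (GaloisRep.toLocal q ρ₁) 1,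
      ∀ w : galoisCohomology (GaloisRep.toLocal q ρ₁) 1,
        singularMap (GaloisRep.toLocal q ρ₂) (localMap i (Sum.inr q) w) =
            D₂.fs q (localMap i (Sum.inr q) y) →
          singularMap (GaloisRep.toLocal q ρ₁) w = D₁.fs q y)
    {n₀ : Finset (HeightOneSpectrum (𝓞 K))}
    (hinj : ∀ lam : Finset (HeightOneSpectrum (𝓞 K)) → galoisCohomology ρ₁ 1,
      D₁.IsKolyvaginSystem 𝓕₁ lam → lam n₀ = 0 → ∀ n, lam n = 0)
    {κ : Finset (HeightOneSpectrum (𝓞 K)) → galoisCohomology ρ₂ 1}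
    (hκ : D₂.IsKolyvaginSystem 𝓕₂ κ) (h0 : κ n₀ = 0) (n : Finset (HeightOneSpectrum (𝓞 K))) : κ n = 0 :=
  apply_eq_zero_of_apply_eq_zero_of_devissage i π hexact hinji hP₁ hP₁ hur₁ hur₂ hFπ hTπ hfsπ hFi hTi
    hfsi hinj hinj hκ h0 n

/-- **Corollary: evaluation at `n₀` is injective on `KS(D₂, 𝓕₂)`** (the subgroup form of the
dévissage, self-dual case). [cite: Sakamoto2024, Def. 4.1 and Thm. 4.4 (1) (p. 926)] -/
theorem injective_eval_kolyvaginSystems_of_devissage_self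
    (i : ρ₁.toContRepresentation →ⁱL ρ₂.toContRepresentation)
    (π : ρ₂.toContRepresentation →ⁱL ρ₁.toContRepresentation)
    (hexact : ∀ x, galoisCohomology.map π 1 x = 0 → ∃ y, galoisCohomology.map i 1 y = x)
    (hinji : Function.Injective (galoisCohomology.map i 1))
    {D₁ : KolyvaginDatum ρ₁} {D₂ : KolyvaginDatum ρ₂} (hP₁ : D₁.primes = D₂.primes)
    {𝓕₁ : SelmerStructure ρ₁} {𝓕₂ : SelmerStructure ρ₂}
    (hur₁ : ∀ q ∈ D₂.primes, 𝓕₁ (Sum.inr q) ≤ unramifiedSubgroup (GaloisRep.toLocal q ρ₁) 1)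
    (hur₂ : ∀ q ∈ D₂.primes, 𝓕₂ (Sum.inr q) ≤ unramifiedSubgroup (GaloisRep.toLocal q ρ₂) 1)
    (hFπ : ∀ v, ∀ y ∈ 𝓕₂ v, localMap π v y ∈ 𝓕₁ v)
    (hTπ : ∀ q ∈ D₂.primes, ∀ y ∈ D₂.transverse (Sum.inr q),
      localMap π (Sum.inr q) y ∈ D₁.transverse (Sum.inr q))
    (hfsπ : ∀ q ∈ D₂.primes, ∀ y ∈ unramifiedSubgroup (GaloisRep.toLocal q ρ₂) 1,
      ∀ w : galoisCohomology (GaloisRep.toLocal q ρ₂) 1,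
        singularMap (GaloisRep.toLocal q ρ₂) w = D₂.fs q y →
          singularMap (GaloisRep.toLocal q ρ₁) (localMap π (Sum.inr q) w) =
            D₁.fs q (localMap π (Sum.inr q) y))
    (hFi : ∀ v x, localMap i v x ∈ 𝓕₂ v → x ∈ 𝓕₁ v)
    (hTi : ∀ q ∈ D₂.primes, ∀ x, localMap i (Sum.inr q) x ∈ D₂.transverse (Sum.inr q) →
      x ∈ D₁.transverse (Sum.inr q))
    (hfsi : ∀ q ∈ D₂.primes, ∀ y ∈ unramifiedSubgroup (GaloisRep.toLocal q ρ₁) 1,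
      ∀ w : galoisCohomology (GaloisRep.toLocal q ρ₁) 1,
        singularMap (GaloisRep.toLocal q ρ₂) (localMap i (Sum.inr q) w) =
            D₂.fs q (localMap i (Sum.inr q) y) →
          singularMap (GaloisRep.toLocal q ρ₁) w = D₁.fs q y)
    {n₀ : Finset (HeightOneSpectrum (𝓞 K))}
    (hinj : ∀ lam : Finset (HeightOneSpectrum (𝓞 K)) → galoisCohomology ρ₁ 1,
      D₁.IsKolyvaginSystem 𝓕₁ lam → lam n₀ = 0 → ∀ n, lam n = 0) :
    Function.Injective fun κ : D₂.kolyvaginSystems 𝓕₂ => κ.1 n₀ := by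
  intro κ κ' hκκ'
  have hmem : κ.1 - κ'.1 ∈ D₂.kolyvaginSystems 𝓕₂ := sub_mem κ.2 κ'.2
  have h0 : (κ.1 - κ'.1) n₀ = 0 := by
    change κ.1 n₀ - κ'.1 n₀ = 0
    exact sub_eq_zero.mpr hκκ'
  have hall := apply_eq_zero_of_apply_eq_zero_of_devissage_self i π hexact hinji hP₁ hur₁ hur₂ hFπ
    hTπ hfsπ hFi hTi hfsi hinj ((KolyvaginDatum.mem_kolyvaginSystems_iff _ _ _).mp hmem) h0
  apply Subtype.ext
  funext n
  exact sub_eq_zero.mp (hall n)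

end Summit.BirchSwinnertonDyer.Rank1Residual.GaloisImage.KSDevissage

end
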